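import Summits.CriticalPhenomena.PercolationContinuityZ3.Theorems.Transplant.FKConnectivityAllQAntipodalEmbed
import Summits.CriticalPhenomena.PercolationContinuityZ3.Theorems.Transplant.FKConnectivityAllQWheelAutomaton
import Summits.CriticalPhenomena.PercolationContinuityZ3.Theorems.Transplant.FKConnectivityAllQAntipodalAnd4Series
import Summits.CriticalPhenomena.PercolationContinuityZ3.Theorems.Transplant.FKConnectivityAllQSPWagner
import Literature.Probability.Percolation.BondTriangularEstimates
import HarnessLib

/-!
# Connectivity correlation inequalities for `φ_{w,q}`, every `q > 0` — ROOT-FORM CALCULUS, file 61l: the VIRTUAL APEX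
# (a root path through a fresh vertex along an embedding of vertex types)

Support file (`--supports stmt-CriticalPhenomena-4575`), FK sub-lane `prim-bschramm-fk-2` (gen 29); builds on p205010 (kernel theorem,
internal audit signed; external expert review pending).  No definitions, no named facts, no sorries; standard axioms.  Memo
FROM-fk-2-g28-ROOT-FORM.md §7 (L4): the bridge from the abstract root-form calculus (`FK.RootForm.*`, files 61a–61e) to real boxes needs a
VIRTUAL ROOT between the poles `c, d` of a box — contracted (single-box inequality A1) or free (A3n) — and between the poles of the pair
`B_y ∥ B_z` (the AND facts of the word theorem).  In a simple graph the pole pair `cd` may already be an edge of the box, so the virtual root is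
realised as a PATH `c – r – d` through a fresh vertex `r` after transporting the host along an embedding `j : V ↪ U` with `r ∉ range j`
(`…AntipodalEmbed.lean`): contracting both `j c r` and `r j d` identifies the poles, contracting `r j d` alone and leaving `j c r` free is a free
root.  This file proves the bookkeeping: reachability is preserved and reflected by `j` (`FK.reachable_map_iff_of_embedding`), the apex is
isolated in every image configuration, the cluster counts of `j X ∪ {j c r}` and `j X ∪ {j c r, r j d}` (`FK.clusterCount_insert_apex₁/₂`), the
three cell exponents with the apex path contracted / half free (`FK.apExpC_map_apex_contract`, `FK.apExpC_map_apex_free₁/₂` — the images of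
`FK.apExpC_insert_root_contract` / `…live₁/₂` without any hypothesis on the pole pair), and that `j F ∪ {j c r, r j d}` is two-terminal
series–parallel between `j c, j d` whenever `F` is between `c, d`, together with its Duffin re-rooting at any edge of `F`
(`FK.isTTSP_map_apex`, `FK.isTTSP_map_apex_reroot`).
[cite: Grimmett2006, §1.2 eq. (1.1) (p. 4); §1.4 eq. (1.20) (p. 15); §3.8 (pp. 61–62)]
-/

noncomputable section

namespace Summit.CriticalPhenomena.PercolationContinuityZ3.Theorems

namespace FK

open SimpleGraph Literature.Probability.LatticeModels Literature.Probability.Percolation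
open scoped Classical

variable {V U : Type*} (j : V ↪ U)

section ApexReach

/-- **Reachability is preserved and reflected by an embedding of vertex types.** [folklore] -/
theorem reachable_map_iff_of_embedding (X : Finset (Sym2 V)) (a b : V) :
    (openGraph (↑(X.map j.sym2Map) : BondConfig U)).Reachable (j a) (j b) ↔ (openGraph (↑X : BondConfig V)).Reachable a b := by
  constructor
  · intro h
    have key := BondTri.reachable_of_reachable_map j.injective (ω := (↑(X.map j.sym2Map) : Set (Sym2 U)))
      (fun e he => by
        rw [Finset.mem_coe, Finset.mem_map] at he
        obtain ⟨e', -, rfl⟩ := he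
        exact ⟨e', rfl⟩) (x := a) (y := b) h
    have hres : restrictConfig j (↑(X.map j.sym2Map) : BondConfig U) = (↑X : BondConfig V) := restrictConfig_coe_map j X
    rw [hres] at key
    exact key
  · intro h
    have key := reachable_map_of_restrictConfig j.injective (↑(X.map j.sym2Map) : BondConfig U) (x := a) (y := b)
    rw [restrictConfig_coe_map] at key
    exact key h

variable {j}

/-- The image of an edge of `V` is the corresponding pair of images. [folklore] -/
theorem sym2Map_mk (u v : V) : j.sym2Map s(u, v) = s(j u, j v) := by
  rw [Function.Embedding.sym2Map_apply, Sym2.map_mk]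

/-- A vertex off the range of `j` lies on no image pair. [folklore] -/
theorem apex_notMem_of_mem_map {r : U} (hr : r ∉ Set.range j) (X : Finset (Sym2 V)) : ∀ e ∈ X.map j.sym2Map, r ∉ e := by
  intro e he hre
  rw [Finset.mem_map] at he
  obtain ⟨e', -, rfl⟩ := he
  rw [mem_sym2Map_iff] at hre
  obtain ⟨w, -, hw⟩ := hre
  exact hr ⟨w, hw⟩

/-- The apex is isolated in every image configuration. [folklore] -/
theorem not_reachable_apex {r : U} (hr : r ∉ Set.range j) (X : Finset (Sym2 V)) (a : V) :
    ¬ (openGraph (↑(X.map j.sym2Map) : BondConfig U)).Reachable (j a) r :=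
  Wheel.not_reachable_of_fresh (apex_notMem_of_mem_map hr X) (fun h => hr ⟨a, h⟩)

end ApexReach

section ApexCount

variable {j} [Fintype U]

/-- Cluster count of an image configuration: the idle vertices are isolated. [cite: Grimmett2006, §1.2 eq. (1.1) (p. 4)] -/
theorem clusterCount_map_eq (X : Finset (Sym2 V)) :
    clusterCount (↑(X.map j.sym2Map) : BondConfig U) ∅ = clusterCount (↑X : BondConfig V) ∅ + Nat.card {u : U // u ∉ Set.range j} := by
  have h := clusterCount_map_image j X ∅
  rwa [Set.image_empty] at h

/-- **Pendant apex edge**: joining the apex `r` to `j c` lowers the cluster count by one. [cite: Grimmett2006, §1.4 eq. (1.20) (p. 15)] -/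
theorem clusterCount_insert_apex₁ {r : U} (hr : r ∉ Set.range j) (X : Finset (Sym2 V)) (c : V) :
    clusterCount (↑(insert s(j c, r) (X.map j.sym2Map)) : BondConfig U) ∅ + 1 = clusterCount (↑(X.map j.sym2Map) : BondConfig U) ∅ := by
  have h := clusterCount_insert_add_ite (X.map j.sym2Map) (j c) r
  rwa [if_neg (not_reachable_apex hr X c)] at h

/-- **The apex path**: joining `r` to `j c` and to `j d` lowers the cluster count by `1 + 1{c ↮ d in X}` — the path acts as the pole pair
contracted. [cite: Grimmett2006, §1.4 eq. (1.20) (p. 15)] -/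
theorem clusterCount_insert_apex₂ {r : U} (hr : r ∉ Set.range j) (X : Finset (Sym2 V)) (c d : V) :
    clusterCount (↑(insert s(r, j d) (insert s(j c, r) (X.map j.sym2Map))) : BondConfig U) ∅ +
        (if (openGraph (↑X : BondConfig V)).Reachable c d then 1 else 2) =
      clusterCount (↑(X.map j.sym2Map) : BondConfig U) ∅ := by
  have h1 := clusterCount_insert_apex₁ hr X c
  have h2 := clusterCount_insert_add_ite (insert s(j c, r) (X.map j.sym2Map)) r (j d)
  have n1 : ¬ (openGraph (↑(X.map j.sym2Map) : BondConfig U)).Reachable r (j d) := fun h => not_reachable_apex hr X d h.symm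
  have n2 : ¬ (openGraph (↑(X.map j.sym2Map) : BondConfig U)).Reachable r (j c) := fun h => not_reachable_apex hr X c h.symm
  have iff : (openGraph (↑(insert s(j c, r) (X.map j.sym2Map)) : BondConfig U)).Reachable r (j d) ↔
      (openGraph (↑X : BondConfig V)).Reachable c d := by
    rw [Wheel.reachable_coe_insert_iff]
    simp only [n1, n2, false_and, false_or, SimpleGraph.Reachable.refl r, true_and]
    exact reachable_map_iff_of_embedding j X c d
  by_cases hcd : (openGraph (↑X : BondConfig V)).Reachable c d
  · rw [if_pos hcd]; rw [if_pos (iff.2 hcd)] at h2; omega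
  · rw [if_neg hcd]; rw [if_neg (fun h => hcd (iff.1 h))] at h2; omega

/-- **Cell exponent with the apex path CONTRACTED** (poles identified): for all `M, C, γ`,
`apExpC (j M) (j C ∪ {j c r, r j d}) (j γ) + 4 = apExpC M C γ + 2·#idle + 1{c↔d in γ∪C} + 1{c↔d in (M\γ)∪C}` — the image of
`FK.apExpC_insert_root_contract` with no hypothesis on the pole pair `cd`. [cite: Grimmett2006, §1.4 eq. (1.20) (p. 15); Thm. (3.1)(a)] -/
theorem apExpC_map_apex_contract {r : U} (hr : r ∉ Set.range j) (M C γ : Finset (Sym2 V)) (c d : V) :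
    apExpC (M.map j.sym2Map) (C.map j.sym2Map ∪ ({s(j c, r)} ∪ {s(r, j d)})) (γ.map j.sym2Map) + 4 =
      apExpC M C γ + 2 * Nat.card {u : U // u ∉ Set.range j} +
        (if (openGraph (↑(γ ∪ C) : BondConfig V)).Reachable c d then 1 else 0) +
        (if (openGraph (↑(M \ γ ∪ C) : BondConfig V)).Reachable c d then 1 else 0) := by
  have e1 : γ.map j.sym2Map ∪ (C.map j.sym2Map ∪ ({s(j c, r)} ∪ {s(r, j d)})) =
      insert s(r, j d) (insert s(j c, r) ((γ ∪ C).map j.sym2Map)) := by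
    rw [Finset.map_union, Finset.insert_eq, Finset.insert_eq]; ac_rfl
  have e2 : M.map j.sym2Map \ γ.map j.sym2Map ∪ (C.map j.sym2Map ∪ ({s(j c, r)} ∪ {s(r, j d)})) =
      insert s(r, j d) (insert s(j c, r) ((M \ γ ∪ C).map j.sym2Map)) := by
    rw [← map_sdiff_sym2Map, Finset.map_union, Finset.insert_eq, Finset.insert_eq]; ac_rfl
  unfold apExpC
  rw [e1, e2]
  have k1 := clusterCount_insert_apex₂ hr (γ ∪ C) c d
  have k2 := clusterCount_insert_apex₂ hr (M \ γ ∪ C) c d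
  have m1 := clusterCount_map_eq (j := j) (γ ∪ C)
  have m2 := clusterCount_map_eq (j := j) (M \ γ ∪ C)
  split_ifs at k1 k2 ⊢ <;> omega

/-- **Cell exponent with the apex path HALF FREE, the free half on the first side**: `e = j c r` free and in replica 1, `r j d` contracted:
`apExpC (j M ∪ e) (j C ∪ {r j d}) (j γ ∪ e) + 3 = apExpC M C γ + 2·#idle + 1{c↔d in γ∪C}` — the image of
`FK.apExpC_insert_root_live₁`. [cite: Grimmett2006, §1.4 eq. (1.20) (p. 15); Thm. (3.1)(a)] -/
theorem apExpC_map_apex_free₁ {r : U} (hr : r ∉ Set.range j) (M γ C : Finset (Sym2 V)) (c d : V) :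
    apExpC (insert s(j c, r) (M.map j.sym2Map)) (C.map j.sym2Map ∪ {s(r, j d)}) (insert s(j c, r) (γ.map j.sym2Map)) + 3 =
      apExpC M C γ + 2 * Nat.card {u : U // u ∉ Set.range j} +
        (if (openGraph (↑(γ ∪ C) : BondConfig V)).Reachable c d then 1 else 0) := by
  have heM : s(j c, r) ∉ M.map j.sym2Map := fun h => apex_notMem_of_mem_map hr M _ h (Sym2.mem_mk_right _ _)
  have e1 : insert s(j c, r) (γ.map j.sym2Map) ∪ (C.map j.sym2Map ∪ {s(r, j d)}) =
      insert s(r, j d) (insert s(j c, r) ((γ ∪ C).map j.sym2Map)) := by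
    rw [Finset.map_union, Finset.insert_eq, Finset.insert_eq, Finset.insert_eq]; ac_rfl
  have e2 : insert s(j c, r) (M.map j.sym2Map) \ insert s(j c, r) (γ.map j.sym2Map) ∪ (C.map j.sym2Map ∪ {s(r, j d)}) =
      insert s(r, j d) ((M \ γ ∪ C).map j.sym2Map) := by
    rw [Finset.insert_sdiff_insert, Finset.sdiff_insert_of_notMem heM, ← map_sdiff_sym2Map, Finset.map_union, Finset.insert_eq]
    ac_rfl
  unfold apExpC
  rw [e1, e2]
  have k1 := clusterCount_insert_apex₂ hr (γ ∪ C) c d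
  have k2 := clusterCount_insert_apex₁ hr (M \ γ ∪ C) d
  have m1 := clusterCount_map_eq (j := j) (γ ∪ C)
  have m2 := clusterCount_map_eq (j := j) (M \ γ ∪ C)
  have hsym : insert s(r, j d) ((M \ γ ∪ C).map j.sym2Map) = insert s(j d, r) ((M \ γ ∪ C).map j.sym2Map) := by rw [Sym2.eq_swap]
  rw [hsym]
  split_ifs at k1 ⊢ <;> omega

/-- **Cell exponent with the apex path HALF FREE, the free half on the second side**: `e = j c r ∉ j γ`:
`apExpC (j M ∪ e) (j C ∪ {r j d}) (j γ) + 3 = apExpC M C γ + 2·#idle + 1{c↔d in (M\γ)∪C}` — the image of `FK.apExpC_insert_root_live₂`.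
[cite: Grimmett2006, §1.4 eq. (1.20) (p. 15); Thm. (3.1)(a)] -/
theorem apExpC_map_apex_free₂ {r : U} (hr : r ∉ Set.range j) (M γ C : Finset (Sym2 V)) (c d : V) :
    apExpC (insert s(j c, r) (M.map j.sym2Map)) (C.map j.sym2Map ∪ {s(r, j d)}) (γ.map j.sym2Map) + 3 =
      apExpC M C γ + 2 * Nat.card {u : U // u ∉ Set.range j} +
        (if (openGraph (↑(M \ γ ∪ C) : BondConfig V)).Reachable c d then 1 else 0) := by
  have heγ : s(j c, r) ∉ γ.map j.sym2Map := fun h => apex_notMem_of_mem_map hr γ _ h (Sym2.mem_mk_right _ _)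
  have e1 : γ.map j.sym2Map ∪ (C.map j.sym2Map ∪ {s(r, j d)}) = insert s(j d, r) ((γ ∪ C).map j.sym2Map) := by
    rw [Finset.map_union, Finset.insert_eq, Sym2.eq_swap]; ac_rfl
  have e2 : insert s(j c, r) (M.map j.sym2Map) \ γ.map j.sym2Map ∪ (C.map j.sym2Map ∪ {s(r, j d)}) =
      insert s(r, j d) (insert s(j c, r) ((M \ γ ∪ C).map j.sym2Map)) := by
    rw [Finset.insert_sdiff_of_notMem _ heγ, ← map_sdiff_sym2Map, Finset.map_union, Finset.insert_eq, Finset.insert_eq,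
      Finset.insert_eq]
    ac_rfl
  unfold apExpC
  rw [e1, e2]
  have k1 := clusterCount_insert_apex₁ hr (γ ∪ C) d
  have k2 := clusterCount_insert_apex₂ hr (M \ γ ∪ C) c d
  have m1 := clusterCount_map_eq (j := j) (γ ∪ C)
  have m2 := clusterCount_map_eq (j := j) (M \ γ ∪ C)
  split_ifs at k2 ⊢ <;> omega

end ApexCount

section ApexTTSP

variable {j}

/-- **The apex path is a parallel strand**: `F` TTSP between `c, d`, `r ∉ range j` ⟹ `j F ∪ {j c r, r j d}` is TTSP between `j c, j d`.
[folklore] -/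
theorem isTTSP_map_apex {F : Finset (Sym2 V)} {c d : V} (hF : IsTTSP F c d) {r : U} (hr : r ∉ Set.range j) :
    IsTTSP (F.map j.sym2Map ∪ ({s(j c, r)} ∪ {s(r, j d)})) (j c) (j d) := by
  have hcr : j c ≠ r := fun h => hr ⟨c, h⟩
  have hdr : j d ≠ r := fun h => hr ⟨d, h⟩
  have hcd : j c ≠ j d := j.injective.ne hF.ne
  refine IsTTSP.parallel (hF.map j) (IsTTSP.path₂ hcr hdr.symm hcd) ?_ ?_
  · rw [Finset.disjoint_union_right, Finset.disjoint_singleton_right, Finset.disjoint_singleton_right]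
    exact ⟨fun h => apex_notMem_of_mem_map hr F _ h (Sym2.mem_mk_right _ _),
      fun h => apex_notMem_of_mem_map hr F _ h (Sym2.mem_mk_left _ _)⟩
  · intro z hz1 hz2
    obtain ⟨e, he, hze⟩ := hz2
    have hzr : z ≠ r := by
      rintro rfl
      obtain ⟨e1, he1, hre1⟩ := hz1
      exact apex_notMem_of_mem_map hr F e1 he1 hre1
    rcases Finset.mem_union.1 he with he | he <;> rw [Finset.mem_singleton] at he <;> subst he <;>
      rcases Sym2.mem_iff.1 hze with rfl | rfl
    · exact Or.inl rfl
    · exact absurd rfl hzr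
    · exact absurd rfl hzr
    · exact Or.inr rfl

/-- **Duffin re-rooting of the host with apex path at an edge `uv ∈ F`**: `(j F ∪ {j c r, r j d} ∪ {j c j d}) \ {j u j v}` is TTSP between
`j u, j v`. (The inserted pole pair is harmless: extra edges outside the cell are deleted edges.) [folklore] -/
theorem isTTSP_map_apex_reroot {F : Finset (Sym2 V)} {c d : V} (hF : IsTTSP F c d) {r : U} (hr : r ∉ Set.range j) {u v : V}
    (huv : s(u, v) ∈ F) :
    IsTTSP ((insert s(j c, j d) (F.map j.sym2Map ∪ ({s(j c, r)} ∪ {s(r, j d)}))).erase s(j u, j v)) (j u) (j v) := by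
  refine (isTTSP_map_apex hF hr).reroot_erase (Finset.mem_insert_of_mem (Finset.mem_union_left _ ?_)) ?_
  · rw [← sym2Map_mk, Finset.mem_map' j.sym2Map]; exact huv
  · intro h
    have hmem : s(j c, r) ∈ insert s(j c, j d) (F.map j.sym2Map ∪ ({s(j c, r)} ∪ {s(r, j d)})) :=
      Finset.mem_insert_of_mem (Finset.mem_union_right _ (Finset.mem_union_left _ (Finset.mem_singleton_self _)))
    rw [h, Finset.mem_singleton] at hmem
    have hr' : r ∈ s(j u, j v) := hmem ▸ Sym2.mem_mk_right _ _
    rcases Sym2.mem_iff.1 hr' with h' | h'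
    · exact hr ⟨u, h'.symm⟩
    · exact hr ⟨v, h'.symm⟩

end ApexTTSP

end FK

end Summit.CriticalPhenomena.PercolationContinuityZ3.Theorems

end
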